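/-
Copyright (c) 2026 the pub-hodgecm-mathlib formalisation cell (harness21).  Prover seat hodgecm-mathlib-F0P3a-p05 (g17): road «S3-ram» (LEAD F0P3a-plan (g13); architect
A-p16 (g32); owner F0P3a-p06 (g15)), DEAL T «RESIDUAL TOKEN DICTIONARY» for the ISO HEAD; 2026-09-02.
-/
import Literature.NumberTheory.Automorphic.UnitaryLatticeTreeRootStarPredicateCountRamified   -- ★ G3⁗ (F0P2-p06 (g13)): `exists_unit_v_sub_mul_sq_lt_one_iff_residue`; brings ★ G3′ `residue_map_sigma_eq`, `map_coe_mem_integer`, `residue_eq_zero_iff_v_lt_one`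
import Literature.NumberTheory.Rogawski1990.DepthZeroKappaTransferTypeOneRamifiedRootLineCountsLattice   -- ★ ROW-ROOT-CNT-L (F0P2-p02): the finite-field step `exists_ne_zero_eq_mul_sq_iff_quadraticChar` (`(∃ ā ≠ 0, t̄ = s̄·ā²) ↔ χ(s̄⁻¹t̄) = 1`)
import HarnessLib

/-!
# The lattice graph of a hermitian space — RESIDUAL TOKEN DICTIONARY at a tamely ramified place: the three valuation-level unit tokens of the junction rows
# («`d_j + t·σt·d_k ≡ 0`», «`t² ≡ B`», «`X + c·a² ≡ 0`» for a unit `t`∕`a`) are values of the quadratic character of the residue field (Ireland–Rosen Ch. 8 §1;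
# Tits 1979 §3.5; Rogawski 1990 §4.9)

Topic `NumberTheory/Automorphic`; namespace `Literature.NumberTheory.Automorphic.UnitaryLatticeTree`.  THEOREMS ONLY (no definition, no instance, no notation, no named fact,
no `sorry`); kernel lane `--supports stmt-HodgeConjecture-24833`.  Cell `pub/hodgecm-mathlib` (D-0151), crux H413; road «S3-ram» (Literature seeding, count-neutral); DEAL T of
the ISO HEAD (architect A-p16 (g32), 2026-09-02T02:17:38Z): the type-(1) isoceles sibling of ★ `Rogawski1990/DepthZeroKappaTransferTypeOneRamifiedLiteralTransport` keys the
S45 sockets' three tokens — `hhyp` («`∃ t`, `|t| = 1 ∧ |d_j + t·σt·d_k| < 1`»), BIG («`∃ t`, `|t| = 1 ∧ |t² − B| < 1`»), `lock` («`∃ a`, `|a| = 1 ∧ |X + c·a²| < 1`») — on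
the quadratic character `χ` of the (finite) residue field `𝓀`, and reads the four-literal character table off `χ(res(ε^i)·x) = (−1)^i·χ(x)` for a residual non-square `ε`.

GENERIC over a valued field `K` (value group `ℤᵐ⁰`), `res = IsLocalRing.residue 𝒪[K]`, `χ = quadraticChar 𝓀[K]` (`[Fintype 𝓀[K]] [DecidableEq 𝓀[K]]`); the norm token
needs `σ : K →+* K` valuation-preserving and RESIDUALLY TRIVIAL (`|σx − x| < 1` on `𝒪`, the tame-ramified token), under which `t·σt ≡ t²`.  All constants are given as
`𝒪`-coercions (`(d : K)` for `d : 𝒪[K]`), as in the S45 socket texts.  No Hensel lemma is involved: every token only asks for a residual zero.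

* §1 `quadraticChar_mul_inv_eq_quadraticChar_mul`, `quadraticChar_residue_pow_mul` (T4); the finite-field step `(∃ ā ≠ 0, t̄ = s̄·ā²) ↔ χ(s̄⁻¹t̄) = 1` is ★
  `Rogawski1990.exists_ne_zero_eq_mul_sq_iff_quadraticChar` (imported, not restated).
* §2 THE THREE TOKENS: **`exists_unit_v_add_mul_sq_lt_one_iff_quadraticChar`** (T3, `lock`: `↔ χ(−(X̄·c̄⁻¹)) = 1`), **`exists_unit_v_sq_sub_lt_one_iff_quadraticChar`** (T2, BIG:
  `↔ χ(B̄) = 1`), `v_add_mul_norm_mul_lt_one_iff_v_add_mul_sq_lt_one` (`t·σt ≡ t²`), **`exists_unit_v_add_mul_norm_mul_lt_one_iff_quadraticChar`** (T1, `hhyp`: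
  `↔ χ(−(d̄_j·d̄_k)) = 1`).

HONEST LABEL: HC_CM is proved only modulo the 2 remaining named inputs (hLiu418 24832, h413 24833) until rung 0 closes; nothing printed is asserted here (residual bookkeeping);
«S3-ram» has no books consequence.
-/

open scoped Valued WithZero

namespace Literature.NumberTheory.Automorphic.UnitaryLatticeTree

open Literature.NumberTheory.Automorphic Literature.NumberTheory.Automorphic.HermitianLattice

variable {K : Type*} [Field K] [Valued K ℤᵐ⁰] {σ : K →+* K}

/-! ## §1 The finite-field step and the character table of a non-square -/

omit [Valued K ℤᵐ⁰] in
/-- `χ(x·c⁻¹) = χ(x·c)` for `c ≠ 0` (`c⁻¹ = c·(c⁻¹)²`). [cite: IrelandRosen1990, Ch. 8 §1] -/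
theorem quadraticChar_mul_inv_eq_quadraticChar_mul {k : Type*} [Field k] [Fintype k] [DecidableEq k] (x : k) {c : k} (hc : c ≠ 0) :
    quadraticChar k (x * c⁻¹) = quadraticChar k (x * c) := by
  have h : x * c⁻¹ = x * c * c⁻¹ ^ 2 := by field_simp
  rw [h, map_mul, quadraticChar_sq_one' (inv_ne_zero hc), mul_one]

/-- **(T4) THE CHARACTER TABLE OF A RESIDUAL NON-SQUARE**: `χ(res(ε^i)·x) = (−1)^i·χ(x)` when `χ(res ε) = −1`. [cite: IrelandRosen1990, Ch. 8 §1] [cite: Rogawski1990, §4.9 p. 55] -/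
theorem quadraticChar_residue_pow_mul [Fintype 𝓀[K]] [DecidableEq 𝓀[K]] (ε : 𝒪[K]) (hεχ : quadraticChar 𝓀[K] (IsLocalRing.residue 𝒪[K] ε) = -1) (i : ℕ) (x : 𝓀[K]) :
    quadraticChar 𝓀[K] (IsLocalRing.residue 𝒪[K] (ε ^ i) * x) = (-1) ^ i * quadraticChar 𝓀[K] x := by
  rw [map_mul, map_pow, map_pow, hεχ]

/-! ## §2 The three unit tokens -/

section Tokens

variable [Fintype 𝓀[K]] [DecidableEq 𝓀[K]]

omit [Fintype 𝓀[K]] [DecidableEq 𝓀[K]] in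
/-- A unit of `𝒪` has non-zero residue. [cite: Tits1979, §3.5] -/
theorem residue_ne_zero_of_v_eq_one (c : 𝒪[K]) (hc : Valued.v (c : K) = 1) : IsLocalRing.residue 𝒪[K] c ≠ 0 := fun h => by
  rw [residue_eq_zero_iff_v_lt_one, hc] at h
  exact lt_irrefl _ h

/-- **(T3) THE `lock` TOKEN**: for units `X, c ∈ 𝒪`, «`X + c·a² ≡ 0 (mod ϖ)` for some unit `a`» iff `χ(−(X̄·c̄⁻¹)) = 1`. [cite: Rogawski1990, §4.9 p. 55] [cite: IrelandRosen1990, Ch. 8 §1] -/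
theorem exists_unit_v_add_mul_sq_lt_one_iff_quadraticChar (X c : 𝒪[K]) (hX : Valued.v (X : K) = 1) (hc : Valued.v (c : K) = 1) :
    (∃ a : K, Valued.v a = 1 ∧ Valued.v ((X : K) + (c : K) * a ^ 2) < 1) ↔
      quadraticChar 𝓀[K] (-(IsLocalRing.residue 𝒪[K] X * (IsLocalRing.residue 𝒪[K] c)⁻¹)) = 1 := by
  have _hX := hX
  have hc0 : IsLocalRing.residue 𝒪[K] c ≠ 0 := residue_ne_zero_of_v_eq_one c hc
  have hnc0 : IsLocalRing.residue 𝒪[K] (-c) ≠ 0 := by rw [map_neg]; exact neg_ne_zero.2 hc0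
  have hrw : ∀ a : K, (X : K) + (c : K) * a ^ 2 = (X : K) - ((-c : 𝒪[K]) : K) * a ^ 2 := fun a => by push_cast; ring
  simp_rw [hrw]
  rw [exists_unit_v_sub_mul_sq_lt_one_iff_residue X (-c), Literature.NumberTheory.Rogawski1990.exists_ne_zero_eq_mul_sq_iff_quadraticChar hnc0, map_neg, inv_neg, neg_mul, mul_comm]

/-- **(T2) THE BIG TOKEN**: for a unit `B ∈ 𝒪`, «`t² ≡ B (mod ϖ)` for some unit `t`» iff `χ(B̄) = 1`. [cite: Rogawski1990, §4.9 p. 55] [cite: IrelandRosen1990, Ch. 8 §1] -/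
theorem exists_unit_v_sq_sub_lt_one_iff_quadraticChar (B : 𝒪[K]) (hB : Valued.v (B : K) = 1) :
    (∃ t : K, Valued.v t = 1 ∧ Valued.v (t ^ 2 - (B : K)) < 1) ↔ quadraticChar 𝓀[K] (IsLocalRing.residue 𝒪[K] B) = 1 := by
  have _hB := hB
  have h10 : IsLocalRing.residue 𝒪[K] 1 ≠ 0 := by rw [map_one]; exact one_ne_zero
  have hrw : ∀ t : K, Valued.v (t ^ 2 - (B : K)) = Valued.v ((B : K) - ((1 : 𝒪[K]) : K) * t ^ 2) := fun t => by
    rw [← Valuation.map_neg, neg_sub]; push_cast; rw [one_mul]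
  simp_rw [hrw]
  rw [exists_unit_v_sub_mul_sq_lt_one_iff_residue B 1, Literature.NumberTheory.Rogawski1990.exists_ne_zero_eq_mul_sq_iff_quadraticChar h10, map_one, inv_one, one_mul]

omit [Fintype 𝓀[K]] [DecidableEq 𝓀[K]] in
/-- `|x| < 1 ↔ |y| < 1` when `|x − y| < 1` (ultrametric). [cite: Tits1979, §3.5] -/
theorem v_lt_one_iff_of_v_sub_lt_one {x y : K} (h : Valued.v (x - y) < 1) : Valued.v x < 1 ↔ Valued.v y < 1 := by
  constructor
  · intro hx
    have h' : Valued.v (y - x) < 1 := by rw [← Valuation.map_neg, neg_sub]; exact h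
    have := Valuation.map_add_lt Valued.v hx h'
    rwa [add_sub_cancel] at this
  · intro hy
    have := Valuation.map_add_lt Valued.v hy h
    rwa [add_sub_cancel] at this

omit [Fintype 𝓀[K]] [DecidableEq 𝓀[K]] in
/-- **`t·σt ≡ t²`**: for a residually trivial valuation-preserving `σ`, a unit `t` and integral `d_j, d_k`: `|d_j + t·σt·d_k| < 1 ↔ |d_j + d_k·t²| < 1`. [cite: Tits1979, §3.5] -/
theorem v_add_mul_norm_mul_lt_one_iff_v_add_mul_sq_lt_one (hvσ : ∀ a, Valued.v (σ a) = Valued.v a) (hres : ∀ x : K, Valued.v x ≤ 1 → Valued.v (σ x - x) < 1)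
    (dj dk : 𝒪[K]) {t : K} (ht : Valued.v t = 1) :
    Valued.v ((dj : K) + t * σ t * (dk : K)) < 1 ↔ Valued.v ((dj : K) + (dk : K) * t ^ 2) < 1 := by
  have _h := hvσ
  refine v_lt_one_iff_of_v_sub_lt_one ?_
  have hrw : (dj : K) + t * σ t * (dk : K) - ((dj : K) + (dk : K) * t ^ 2) = t * (dk : K) * (σ t - t) := by ring
  rw [hrw, Valuation.map_mul, Valuation.map_mul, ht, one_mul]
  calc Valued.v (dk : K) * Valued.v (σ t - t) ≤ 1 * Valued.v (σ t - t) := mul_le_mul_left dk.2 _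
    _ < 1 := by rw [one_mul]; exact hres t ht.le

/-- **(T1) THE `hhyp` (NORM) TOKEN**: for a residually trivial valuation-preserving `σ` and units `d_j, d_k ∈ 𝒪`, «`d_j + t·σt·d_k ≡ 0 (mod ϖ)` for some unit `t`» iff
`χ(−(d̄_j·d̄_k)) = 1`. [cite: Rogawski1990, §4.9 p. 55] [cite: Tits1979, §3.5] [cite: IrelandRosen1990, Ch. 8 §1] -/
theorem exists_unit_v_add_mul_norm_mul_lt_one_iff_quadraticChar (hvσ : ∀ a, Valued.v (σ a) = Valued.v a) (hres : ∀ x : K, Valued.v x ≤ 1 → Valued.v (σ x - x) < 1)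
    (dj dk : 𝒪[K]) (hj : Valued.v (dj : K) = 1) (hk : Valued.v (dk : K) = 1) :
    (∃ t : K, Valued.v t = 1 ∧ Valued.v ((dj : K) + t * σ t * (dk : K)) < 1) ↔
      quadraticChar 𝓀[K] (-(IsLocalRing.residue 𝒪[K] dj * IsLocalRing.residue 𝒪[K] dk)) = 1 := by
  have hk0 : IsLocalRing.residue 𝒪[K] dk ≠ 0 := residue_ne_zero_of_v_eq_one dk hk
  have hiff : (∃ t : K, Valued.v t = 1 ∧ Valued.v ((dj : K) + t * σ t * (dk : K)) < 1) ↔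
      ∃ t : K, Valued.v t = 1 ∧ Valued.v ((dj : K) + (dk : K) * t ^ 2) < 1 :=
    exists_congr fun t => and_congr_right fun ht => v_add_mul_norm_mul_lt_one_iff_v_add_mul_sq_lt_one hvσ hres dj dk ht
  rw [hiff, exists_unit_v_add_mul_sq_lt_one_iff_quadraticChar dj dk hj hk, ← neg_mul, ← neg_mul,
    quadraticChar_mul_inv_eq_quadraticChar_mul _ hk0]

end Tokens

end Literature.NumberTheory.Automorphic.UnitaryLatticeTree
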